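import Mathlib
import Summits.ValiantsHypothesis.ValiantsHypothesis.Theorems.PermanentalConesPermanentalHyperbolic
import Summits.ValiantsHypothesis.ValiantsHypothesis.Theorems.PermanentalConesPermanentalConeHardSlackAsPermanent
import Literature.AlgebraicGeometry.HyperbolicPolynomials.HyperbolicityCone
import Literature.AlgebraicGeometry.HyperbolicPolynomials.Garding
import Literature.AlgebraicGeometry.HyperbolicPolynomials.DerivativeCone
import Literature.AlgebraicGeometry.HyperbolicPolynomials.ElementarySymmetricCone
import Literature.Analysis.Convex.SpectralConeLift

/-!
# `PermanentalConeHard` (stmt-ValiantsHypothesis-8654) — one more positive row is one derivative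
# relaxation step in the eigenvalue picture

Route `PermanentalCones` of `ValiantsHypothesis`, crux `PermanentalConeHard` (H+).  The members of
the permanental family are iterated directional derivatives of the orthant polynomial in the
constant rows (Gurvits, tree lemma `sum_C_mul_pderiv_rowPermanent`:
`Σ_j Y_{kj} ∂_j Q_k = (n-k) · Q_{k+1}` for `Q_k = per[(Y)_{rows<k}; x^{(n-k)}]`).  Combined with
Renegar's description of the derivative cone (tree file `Literature/…/DerivativeCone.lean`,
`mem_hyperbolicityCone_sum_smul_pderiv_iff`) and Gårding's direction change, this gives the
structure theorem used by every lift construction on the Easy side and by every witness-pool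
reduction on the H+ side:

* `mem_openHyperbolicityCone_rowPermanent_of_pos_row` — a positive vector `y` lies in the OPEN
  cone `Λ₊₊(Q_k, 𝟙)` as soon as the constant rows are nonnegative and `Q_k(𝟙) ≠ 0`.
* `sum_smul_pderiv_rowPermanent` — `Σ_j y_j • ∂_j Q_k = (n-k) • Q_{k+1}` for `y = Y_k` (Gurvits'
  identity in `•` form).
* `mem_hyperbolicityCone_rowPermanent_succ_iff` (= registered infrastructure stub
  `stub_rowStepEigen`) — **ROW STEP**: for `k < n`, nonnegative rows `< k`, a POSITIVE row `k`
  (`y = Y_k`) and `Q_k(𝟙) ≠ 0`,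
  `x ∈ Λ₊(Q_{k+1}, 𝟙) ↔ v ∈ Λ₊(e_{n-k-1}^{(n-k)}, 𝟙)` for any enumeration `v` of the
  eigenvalues of `x` w.r.t. `(Q_k, y)`: the cone with one more positive row is the preimage of the
  first derivative relaxation of the orthant `ℝ^{n-k}_+` under the hyperbolic eigenvalue map of
  the previous member in the direction of the new row.  For `k = 0` the eigenvalues are
  `x_j / y_j` and one recovers `Λ₊(D_y e_n) = Diag(y) Λ₊(e_{n-1})` (tree: `stub_oneRowNotWitness`);
  for `k = 1` they are generalized eigenvalues of a compression pencil (tree: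
  `stub_twoRowsNotWitness`); for `k ≥ 2` they are roots of secular equations
  (`Cruxes/PermanentalConeHard/CORE-analysis-c5.md` §3) — the first open case of the Easy crux
  8652 is exactly the semidefinite representability of sums of the largest such eigenvalues.

References: L. Gurvits, arXiv:math/0510452 §2 (polarisation); J. Renegar, Found. Comput. Math. 6
(2006) §4, Prop. 18, Thm. 20 (derivative cone); L. Gårding 1959 (direction change).  Everything
here is proved in full.
-/

set_option linter.dupNamespace false

noncomputable section

namespace Summit.ValiantsHypothesis.ValiantsHypothesis.Theorems.PermanentalConesPermanentalConeHard

open MvPolynomial Finset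
open scoped BigOperators
open Literature.AlgebraicGeometry.HyperbolicPolynomials

namespace RowStep

variable {n : ℕ}

/-- The permanental polynomial with `k` constant rows is homogeneous of degree `n - k` (`k ≤ n`).
[folklore] -/
theorem isHomogeneous_rowPermanent_sub (Y : Fin n → Fin n → ℝ) {k : ℕ} (hk : k ≤ n) :
    (Matrix.of fun a b : Fin n =>
        if (a : ℕ) < k then C (Y a b) else (X b : MvPolynomial (Fin n) ℝ)).permanent.IsHomogeneous
      (n - k) := by
  have h := isHomogeneous_rowPermanent Y k
  have hsum : (∑ j : Fin n, (if (j : ℕ) < k then 0 else 1)) = n - k := by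
    rw [Finset.sum_ite, Finset.sum_const_zero, zero_add, Finset.sum_const, smul_eq_mul, mul_one]
    have hlt := Literature.Analysis.Convex.card_filter_val_lt (N := n) hk
    have htot : (univ.filter (fun j : Fin n => (j : ℕ) < k)).card +
        (univ.filter (fun j : Fin n => ¬ (j : ℕ) < k)).card = n := by
      rw [Finset.card_filter_add_card_filter_not, Finset.card_univ, Fintype.card_fin]
    omega
  rwa [hsum] at h

/-- **A positive vector lies in the open cone** `Λ₊₊(Q_k, 𝟙)` of `Q_k = per[(Y)_{rows<k}; x^{(n-k)}]`
when the constant rows are nonnegative and `Q_k(𝟙) ≠ 0`: `Q_k(y + τ𝟙) ≥ Q_k(c𝟙) = c^{n-k} Q_k(𝟙) > 0`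
for `c = min_j y_j` (monotonicity of nonnegative permanents). [folklore] -/
theorem mem_openHyperbolicityCone_rowPermanent_of_pos_row (Y : Fin n → Fin n → ℝ) {k : ℕ}
    (hk : k ≤ n) (hY : ∀ a b : Fin n, (a : ℕ) < k → 0 ≤ Y a b)
    (h1 : MvPolynomial.eval (fun _ => (1 : ℝ)) (Matrix.of fun a b : Fin n =>
        if (a : ℕ) < k then C (Y a b) else (X b : MvPolynomial (Fin n) ℝ)).permanent ≠ 0)
    {y : Fin n → ℝ} (hy : ∀ j, 0 < y j) :
    y ∈ openHyperbolicityCone (Matrix.of fun a b : Fin n =>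
        if (a : ℕ) < k then C (Y a b) else (X b : MvPolynomial (Fin n) ℝ)).permanent
      (fun _ => (1 : ℝ)) := by
  classical
  set Q := (Matrix.of fun a b : Fin n =>
    if (a : ℕ) < k then C (Y a b) else (X b : MvPolynomial (Fin n) ℝ)).permanent with hQ
  -- a positive lower bound `c ≤ y j`
  obtain ⟨c, hc, hcy⟩ : ∃ c : ℝ, 0 < c ∧ ∀ j, c ≤ y j := by
    rcases isEmpty_or_nonempty (Fin n) with hn | hn
    · exact ⟨1, one_pos, fun j => (IsEmpty.false j).elim⟩
    · obtain ⟨j₀, -, hj₀⟩ := Finset.exists_min_image Finset.univ y Finset.univ_nonempty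
      exact ⟨y j₀, hy j₀, fun j => hj₀ j (Finset.mem_univ j)⟩
  -- `Q(𝟙) > 0`
  have hpos1 : 0 < MvPolynomial.eval (fun _ => (1 : ℝ)) Q := by
    refine lt_of_le_of_ne ?_ (Ne.symm h1)
    rw [hQ, eval_rowPermanent]
    refine permanent_nonneg fun a b => ?_
    simp only [Matrix.of_apply]
    split_ifs with hab
    · exact hY a b hab
    · exact zero_le_one
  intro τ hτ
  -- `Q(c𝟙) = c^{n-k} Q(𝟙) > 0`
  have hposc : 0 < MvPolynomial.eval (c • fun _ : Fin n => (1 : ℝ)) Q := by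
    rw [(isHomogeneous_rowPermanent_sub Y hk).eval_smul_eq]
    exact mul_pos (pow_pos hc _) hpos1
  refine (lt_of_lt_of_le hposc ?_).ne'
  rw [hQ, eval_rowPermanent, eval_rowPermanent]
  refine permanent_le_permanent_of_le (fun a b => ?_) (fun a b => ?_)
  · simp only [Matrix.of_apply, Pi.smul_apply, smul_eq_mul, mul_one]
    split_ifs with hab
    · exact hY a b hab
    · exact hc.le
  · simp only [Matrix.of_apply, Pi.add_apply, Pi.smul_apply, smul_eq_mul, mul_one]
    split_ifs
    · exact le_rfl
    · linarith [hcy b]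

/-- **Gurvits' identity in `•` form**: `Σ_j Y_{kj} • ∂_j Q_k = (n - k) • Q_{k+1}` (`k < n`).
[cite: Gurvits2008, §2 (polarisation)] -/
theorem sum_smul_pderiv_rowPermanent (Y : Fin n → Fin n → ℝ) {k : ℕ} (hk : k < n) :
    (∑ j, Y ⟨k, hk⟩ j • pderiv j (Matrix.of fun a b : Fin n =>
        if (a : ℕ) < k then C (Y a b) else (X b : MvPolynomial (Fin n) ℝ)).permanent) =
      ((n - k : ℕ) : ℝ) • (Matrix.of fun a b : Fin n =>
        if (a : ℕ) < k + 1 then C (Y a b) else (X b : MvPolynomial (Fin n) ℝ)).permanent := by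
  have h := Theorems.sum_C_mul_pderiv_rowPermanent Y hk
  simp only [← smul_eq_C_mul] at h
  rw [h, Finset.sum_const]
  have hcard : (univ.filter (fun a : Fin n => k ≤ (a : ℕ))).card = n - k := by
    have hlt := Literature.Analysis.Convex.card_filter_val_lt (N := n) hk.le
    have htot : (univ.filter (fun j : Fin n => (j : ℕ) < k)).card +
        (univ.filter (fun j : Fin n => ¬ (j : ℕ) < k)).card = n := by
      rw [Finset.card_filter_add_card_filter_not, Finset.card_univ, Fintype.card_fin]
    have heq : (univ.filter (fun a : Fin n => k ≤ (a : ℕ))) =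
        univ.filter (fun j : Fin n => ¬ (j : ℕ) < k) :=
      Finset.filter_congr fun j _ => by simp [not_lt]
    rw [heq]
    omega
  rw [hcard, ← Nat.cast_smul_eq_nsmul ℝ]

end RowStep

open RowStep

/-- **ROW STEP** (one more positive row = one derivative relaxation in the eigenvalue picture).
Let `k < n`, `Y` have nonnegative rows `< k` and a positive row `k` (`y = Y_k`), and let
`Q_k = per[(Y)_{rows<k}; x^{(n-k)}]` satisfy `Q_k(𝟙) ≠ 0`.  Then for every `x` and every
enumeration `v : Fin (n-k) → ℝ` of the eigenvalues of `x` w.r.t. `(Q_k, y)`,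
`x ∈ Λ₊(Q_{k+1}, 𝟙) ↔ v ∈ Λ₊(e_{n-k-1}^{(n-k)}, 𝟙)`.
Chain: `Λ₊(Q_{k+1}, 𝟙) = Λ₊((n-k) • Q_{k+1}, 𝟙) = Λ₊(D_y Q_k, 𝟙) = Λ₊(D_y Q_k, y)` (Gårding; `𝟙`
lies in the open cone of `D_y Q_k` w.r.t. `y` by nesting and `D_yQ_k(𝟙) = (n-k) Q_{k+1}(𝟙) > 0`)
`= λ_{(Q_k,y)}^{-1} Λ₊(e_{n-k-1}, 𝟙)` (Renegar, Thm. 20). [cite: Renegar2006, Theorem 20] -/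
theorem mem_hyperbolicityCone_rowPermanent_succ_iff (n k : ℕ) (hk : k < n)
    (Y : Fin n → Fin n → ℝ) (hY : ∀ a b : Fin n, (a : ℕ) < k → 0 ≤ Y a b) (hy : ∀ j, 0 < Y ⟨k, hk⟩ j)
    (h1 : MvPolynomial.eval (fun _ => (1 : ℝ)) (Matrix.of fun a b : Fin n =>
        if (a : ℕ) < k then C (Y a b) else (X b : MvPolynomial (Fin n) ℝ)).permanent ≠ 0)
    (x : Fin n → ℝ) (v : Fin (n - k) → ℝ)
    (hv : Finset.univ.val.map v = eigenvalues (Matrix.of fun a b : Fin n =>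
        if (a : ℕ) < k then C (Y a b) else (X b : MvPolynomial (Fin n) ℝ)).permanent
          (fun j => Y ⟨k, hk⟩ j) x) :
    x ∈ hyperbolicityCone (Matrix.of fun a b : Fin n =>
        if (a : ℕ) < k + 1 then C (Y a b) else (X b : MvPolynomial (Fin n) ℝ)).permanent
          (fun _ => (1 : ℝ)) ↔
      v ∈ hyperbolicityCone (esymm (Fin (n - k)) ℝ (n - k - 1)) (fun _ => (1 : ℝ)) := by
  classical
  set Q := (Matrix.of fun a b : Fin n =>
    if (a : ℕ) < k then C (Y a b) else (X b : MvPolynomial (Fin n) ℝ)).permanent with hQ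
  set Q' := (Matrix.of fun a b : Fin n =>
    if (a : ℕ) < k + 1 then C (Y a b) else (X b : MvPolynomial (Fin n) ℝ)).permanent with hQ'
  set y : Fin n → ℝ := fun j => Y ⟨k, hk⟩ j with hydef
  have hhom : Q.IsHomogeneous (n - k) := isHomogeneous_rowPermanent_sub Y hk.le
  have hd : 1 ≤ n - k := by omega
  -- `Q` is hyperbolic w.r.t. `𝟙` (real stability, landed `PermanentalHyperbolic`) and w.r.t. `y`
  set Y' : Fin n → Fin n → ℝ := fun a b => if (a : ℕ) < k then Y a b else 0 with hY'def
  have hY' : ∀ a b : Fin n, 0 ≤ Y' a b := by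
    intro a b
    simp only [hY'def]
    split_ifs with hab
    · exact hY a b hab
    · exact le_rfl
  have hQeq : Q = (Matrix.of fun a b : Fin n => if (a : ℕ) < k then
      C (Y' a b) else (X b : MvPolynomial (Fin n) ℝ)).permanent := by
    rw [hQ]
    congr 1
    ext a b
    simp only [Matrix.of_apply, hY'def]
    split_ifs <;> rfl
  have hQhyp : IsHyperbolic Q (fun _ => (1 : ℝ)) := by
    refine ⟨h1, fun x' z hz => ?_⟩
    exact Summit.ValiantsHypothesis.ValiantsHypothesis.Theorems.permanentalHyperbolic_proof n k _
      hY' Q hQeq h1 x' z (by simpa using hz)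
  have hyopen : y ∈ openHyperbolicityCone Q (fun _ => (1 : ℝ)) :=
    mem_openHyperbolicityCone_rowPermanent_of_pos_row Y hk.le hY h1 hy
  have hQhyp_y : IsHyperbolic Q y := hQhyp.of_mem_openHyperbolicityCone hhom hyopen
  -- Gurvits: `D_y Q = (n-k) • Q'`
  have hD : (∑ j, y j • pderiv j Q) = ((n - k : ℕ) : ℝ) • Q' := sum_smul_pderiv_rowPermanent Y hk
  have hc : ((n - k : ℕ) : ℝ) ≠ 0 := by exact_mod_cast (show n - k ≠ 0 by omega)
  -- direction change for `D_y Q`: `𝟙` lies in its open cone w.r.t. `y`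
  have hDhyp : IsHyperbolic (∑ j, y j • pderiv j Q) y := isHyperbolic_sum_smul_pderiv hhom hQhyp_y hd
  have hDhom : (∑ j, y j • pderiv j Q).IsHomogeneous (n - k - 1) := by
    rw [hD, smul_eq_C_mul]
    have h' := isHomogeneous_rowPermanent_sub Y (show k + 1 ≤ n by omega)
    rw [show n - (k + 1) = n - k - 1 by omega] at h'
    exact h'.C_mul _
  have hone_open_Q : (fun _ => (1 : ℝ)) ∈ openHyperbolicityCone Q y :=
    mem_openHyperbolicityCone_comm hhom h1 hyopen
  have hone_closed : (fun _ => (1 : ℝ)) ∈ hyperbolicityCone (∑ j, y j • pderiv j Q) y :=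
    hyperbolicityCone_subset_sum_smul_pderiv hhom hQhyp_y hd
      (openHyperbolicityCone_subset Q y hone_open_Q)
  -- `D_yQ(𝟙) = Q(y) Σᵢ ∏_{j≠i} wⱼ ≠ 0` for the (positive) eigenvalues `w` of `𝟙` w.r.t. `(Q, y)`
  have hone_eval : MvPolynomial.eval (fun _ => (1 : ℝ)) (∑ j, y j • pderiv j Q) ≠ 0 := by
    obtain ⟨w, hw⟩ := exists_eigenvalues_eq_map hhom hQhyp_y (fun _ => (1 : ℝ))
    have hwpos : ∀ i, 0 < w i := fun i =>
      (mem_openHyperbolicityCone_iff_eigenvalues_pos hhom hQhyp_y _).1 hone_open_Q (w i)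
        (by rw [← hw]; exact Multiset.mem_map_of_mem _ (Finset.mem_univ_val i))
    have key := eval_sum_smul_pderiv_add_smul hhom hQhyp_y (fun _ => (1 : ℝ)) hw 0
    rw [zero_smul, add_zero] at key
    rw [key]
    refine mul_ne_zero hQhyp_y.eval_ne_zero (Finset.sum_pos (fun i _ => ?_) ?_).ne'
    · exact Finset.prod_pos fun j _ => by rw [zero_add]; exact hwpos j
    · have : Nonempty (Fin (n - k)) := ⟨⟨0, by omega⟩⟩
      exact Finset.univ_nonempty
  have hone_open : (fun _ => (1 : ℝ)) ∈ openHyperbolicityCone (∑ j, y j • pderiv j Q) y :=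
    mem_openHyperbolicityCone_of_eval_ne_zero hone_closed hone_eval
  have hdir : hyperbolicityCone (∑ j, y j • pderiv j Q) (fun _ => (1 : ℝ)) =
      hyperbolicityCone (∑ j, y j • pderiv j Q) y :=
    hyperbolicityCone_eq_of_mem hDhom hDhyp hone_open
  -- the chain
  calc x ∈ hyperbolicityCone Q' (fun _ => (1 : ℝ))
      ↔ x ∈ hyperbolicityCone ((((n - k : ℕ) : ℝ)) • Q') (fun _ => (1 : ℝ)) := by
        rw [hyperbolicityCone_smul Q' _ hc]
    _ ↔ x ∈ hyperbolicityCone (∑ j, y j • pderiv j Q) (fun _ => (1 : ℝ)) := by rw [hD]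
    _ ↔ x ∈ hyperbolicityCone (∑ j, y j • pderiv j Q) y := by rw [hdir]
    _ ↔ v ∈ hyperbolicityCone (esymm (Fin (n - k)) ℝ (n - k - 1)) (fun _ => (1 : ℝ)) :=
        mem_hyperbolicityCone_sum_smul_pderiv_iff hhom hQhyp_y hd x hv

/-- Registered form (`stub_rowStepEigen`, infrastructure stub of the crux `PermanentalConeHard`):
the ROW STEP in the eigenvalue picture, fully qualified. [cite: Renegar2006, Theorem 20] -/
theorem stub_rowStepEigen : ∀ (n k : ℕ) (hk : k < n) (Y : Fin n → Fin n → ℝ), (∀ a b : Fin n, (a : ℕ) < k → 0 ≤ Y a b) → (∀ j, 0 < Y ⟨k, hk⟩ j) → MvPolynomial.eval (fun _ => (1 : ℝ)) (Matrix.of fun a b : Fin n => if (a : ℕ) < k then MvPolynomial.C (Y a b) else (MvPolynomial.X b : MvPolynomial (Fin n) ℝ)).permanent ≠ 0 → ∀ (x : Fin n → ℝ) (v : Fin (n - k) → ℝ), Finset.univ.val.map v = Literature.AlgebraicGeometry.HyperbolicPolynomials.eigenvalues (Matrix.of fun a b : Fin n => if (a : ℕ) < k then MvPolynomial.C (Y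 a b) else (MvPolynomial.X b : MvPolynomial (Fin n) ℝ)).permanent (fun j => Y ⟨k, hk⟩ j) x → (x ∈ Literature.AlgebraicGeometry.HyperbolicPolynomials.hyperbolicityCone (Matrix.of fun a b : Fin n => if (a : ℕ) < k + 1 then MvPolynomial.C (Y a b) else (MvPolynomial.X b : MvPolynomial (Fin n) ℝ)).permanent (fun _ => (1 : ℝ)) ↔ v ∈ Literature.AlgebraicGeometry.HyperbolicPolynomials.hyperbolicityCone (MvPolynomial.esymm (Fin (n - k)) ℝ (n - k - 1)) (fun _ => (1 : ℝ))) :=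
  fun n k hk Y hY hy h1 x v hv => mem_hyperbolicityCone_rowPermanent_succ_iff n k hk Y hY hy h1 x v hv

end Summit.ValiantsHypothesis.ValiantsHypothesis.Theorems.PermanentalConesPermanentalConeHard

end
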